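import Literature.Probability.LatticeModels.GreenFunctionConformalRadius
import Literature.Probability.Process.BrownianVecHarmonic
import Literature.Probability.Process.ConformalClock
import Literature.Probability.Process.ConformalKilledPath
import Literature.Probability.Process.ConformalLaplacian
import Mathlib.Analysis.Complex.OpenMapping
import Mathlib.Analysis.Complex.RemovableSingularity
import Mathlib.Analysis.SpecialFunctions.Complex.LogDeriv
import Mathlib.Analysis.InnerProductSpace.Calculus
import HarnessLib

/-!
# Kozdron–Lawler 2005, Theorem 1.2 — proved steps of the printed proof (Brownian side):
# `E⁰[log |B_{T_D}|] = -log f'(0)`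

Topic `Literature/Probability/LatticeModels`; second sibling of `GreenFunctionConformalRadius.lean`
(the named fact `greenFunction_origin_eq_log_conformalRadius`, Kozdron–Lawler's Theorem 1.2) next
to `GreenFunctionConformalRadiusProofs.lean` (the discrete steps). Here we prove the CONTINUUM
input of the printed proof (M. J. Kozdron, G. F. Lawler, Electron. J. Probab. 10 (2005), §2.2
eq. (11) "`g_D(x) = Eˣ[log |B_{T_D}|] - log |x|`" together with §2.4 eq. (17) and the remark after
Cor. 2.6, "`lim_{|x|→0} (g_A(x) + log |x|) = -log f_A'(0)`"), i.e. the value AT THE POLE: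

* `KozdronLawler.integral_log_norm_exit_eq_neg_log_deriv` — **for a bounded open `D ⊆ ℂ`, a
  holomorphic bijection `f : D → 𝔻` and a planar Brownian motion `X = x₀ + W` started at the
  point `x₀` with `f(x₀) = 0`, `f'(x₀) ≠ 0`, the exit time `T_D` is a.s. finite,
  `log |X_{T_D} - x₀|` is integrable and `E[log |X_{T_D} - x₀|] = -log |f'(x₀)|`** (the
  logarithm of the conformal radius of `D` seen from `x₀`).

Proof (Kakutani's theorem in the tree's form `IsBrownianVec.integral_stoppedProcess_eq_of_harmonic`,
applied on an exhaustion of `D` by the level sets of `|f|`): the function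
`u(z) = log |(f(z) - f(x₀))/(z - x₀)|` (`= log |dslope f x₀ z|`, value `log |f'(x₀)|` at the pole)
is harmonic on `D` (locally the real part of a holomorphic logarithm, `lap_log_norm_eq_zero`); for
`0 < r < 1` the set `D_r = {|f| < r}` is open with `closure D_r ⊆ {|f| ≤ r}` COMPACT inside `D`
(`isCompact_normLevelSet`: the inverse of `f` is continuous by the open mapping theorem), so
optional stopping at the exit time `T_r` of `D_r` and `t → ∞` (dominated convergence; `T_r < ∞`
a.s., `IsBrownianVec.ae_hitTime_ne_top`) give `E[u(X_{T_r})] = u(x₀) = log |f'(x₀)|`, while at the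
exit point `|f(X_{T_r})| = r` exactly, i.e. `u(X_{T_r}) = log r - log |X_{T_r} - x₀|`. Finally
`r ↑ 1`: `T_r ↑ T_D`, `X_{T_r} → X_{T_D}` by continuity of paths (a limit point inside `D` would
have `|f| = 1`), and `log |X_{T_r} - x₀|` stays bounded (the points `X_{T_r}` lie in the bounded
`D` and outside a fixed ball around `x₀` on which `|f| < 1/2`), so dominated convergence again.

Specialised to the union-of-squares domain `Ã` of `A ∈ 𝒜ⁿ` and its Riemann map
(`KozdronLawler.squareDomain`, `KozdronLawler.IsUnitDiscMap`):
`KozdronLawler.integral_log_norm_exit_squareDomain` — `E⁰[log |B_{T_Ã}|] = -log f_A'(0)`.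

Nothing here is a named fact; no part of Theorem 1.2 beyond these identities is claimed (see the
module docstring of `GreenFunctionConformalRadiusProofs.lean` for what is still missing: the
potential-kernel constant, the KMT coupling and the sharp Beurling estimates).

## References

* M. J. Kozdron, G. F. Lawler, Electron. J. Probab. 10 (2005) 1442–1467, §2.2 (11), §2.4 (17),
  Cor. 2.6 and the remark following it [KozdronLawler2005].
* J.-F. Le Gall, *Brownian Motion, Martingales, and Stochastic Calculus* (2016), Ch. 7 §7.2
  (harmonic functions and exit distributions) [Legall2016].
-/

noncomputable section

open MeasureTheory Filter Set Metric Complex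
open _root_.Topology
open scoped NNReal ENNReal ComplexConjugate
open Literature.Probability.Process
open Literature.Probability.Process.IsBrownianVec (hitTime)

namespace Literature.Probability.LatticeModels

namespace KozdronLawler

/-! ### Harmonicity of `log |g|` for a non-vanishing holomorphic `g` -/

/-- **`log |g|` is harmonic where the holomorphic `g` does not vanish**: read on `ℝ²` through
`toC`, `Δ log |g ∘ toC| = 0` at every `v` with `toC v ∈ D`, `g(toC v) ≠ 0` (locally `log |g|`
is the real part of a holomorphic branch of `log (±g)`). [folklore] -/
theorem lap_log_norm_eq_zero {D : Set ℂ} (hD : IsOpen D) {g : ℂ → ℂ} (hg : DifferentiableOn ℂ g D)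
    {v : Fin 2 → ℝ} (hv : toC v ∈ D) (h0 : g (toC v) ≠ 0) :
    lap (fun w => Real.log ‖g (toC w)‖) v = 0 := by
  -- a sign `s = ±1` with `s · g(toC v)` in the slit plane
  obtain ⟨s, hs1, hsv⟩ : ∃ s : ℂ, ‖s‖ = 1 ∧ s * g (toC v) ∈ slitPlane := by
    rcases mem_slitPlane_or_neg_mem_slitPlane h0 with h | h
    · exact ⟨1, norm_one, by rwa [one_mul]⟩
    · exact ⟨-1, by rw [norm_neg, norm_one], by rwa [neg_one_mul]⟩
  set D' : Set ℂ := D ∩ (fun z => s * g z) ⁻¹' slitPlane with hD'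
  have hcont : ContinuousOn (fun z => s * g z) D := continuousOn_const.mul hg.continuousOn
  have hD'open : IsOpen D' := hcont.isOpen_inter_preimage hD isOpen_slitPlane
  have hvD' : toC v ∈ D' := ⟨hv, hsv⟩
  have hG : DifferentiableOn ℂ (fun z => Complex.log (s * g z)) D' :=
    DifferentiableOn.clog ((differentiableOn_const s).mul (hg.mono inter_subset_left)) fun z hz => hz.2
  -- near `v`, `log |g ∘ toC|` is the real part of `log (s g)`
  have heq : (fun w => Real.log ‖g (toC w)‖) =ᶠ[𝓝 v] rePart 1 fun z => Complex.log (s * g z) := by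
    have hmem : toC ⁻¹' D' ∈ 𝓝 v := (isOpen_preimage_toC hD'open).mem_nhds hvD'
    filter_upwards [hmem] with w _
    rw [rePart_apply, map_one, one_mul, Complex.log_re, norm_mul, hs1, one_mul]
  rw [IsBrownianVec.lap_congr_of_eventuallyEq heq]
  exact lap_rePart_eq_zero hD'open hG 1 hvD'

/-- `log |g ∘ toC|` is real-`C²` (indeed `C^∞`) on `toC⁻¹ D` when the holomorphic `g` does not
vanish on `D`. [folklore] -/
theorem contDiffOn_log_norm {D : Set ℂ} (hD : IsOpen D) {g : ℂ → ℂ} (hg : DifferentiableOn ℂ g D)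
    (h0 : ∀ z ∈ D, g z ≠ 0) {n : WithTop ℕ∞} :
    ContDiffOn ℝ n (fun w => Real.log ‖g (toC w)‖) (toC ⁻¹' D) := by
  have h1 : ContDiffOn ℝ n (fun w => g (toC w)) (toC ⁻¹' D) := contDiffOn_comp_toC hD hg
  have h2 : ContDiffOn ℝ n (fun w => ‖g (toC w)‖) (toC ⁻¹' D) := h1.norm ℝ fun w hw => h0 _ hw
  exact h2.log fun w hw => (norm_pos_iff.2 (h0 _ hw)).ne'

/-! ### The divided difference `(f(z) - f(x₀))/(z - x₀)` of an injective holomorphic map -/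

section Slope

variable {D : Set ℂ} {f : ℂ → ℂ} {c : ℂ}

/-- `dslope f c` is holomorphic on the open `D ∋ c` together with `f` (removable singularity).
[folklore] -/
theorem differentiableOn_dslope (hD : IsOpen D) (hf : DifferentiableOn ℂ f D) (hc : c ∈ D) :
    DifferentiableOn ℂ (dslope f c) D :=
  (Complex.differentiableOn_dslope (hD.mem_nhds hc)).2 hf

/-- For an injective `f` with `f'(c) ≠ 0`, `dslope f c` does not vanish on `D`. [folklore] -/
theorem dslope_ne_zero (hinj : InjOn f D) (hc : c ∈ D) (hder : deriv f c ≠ 0) {z : ℂ} (hz : z ∈ D) :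
    dslope f c z ≠ 0 := by
  by_cases hzc : z = c
  · subst hzc; rwa [dslope_same]
  · rw [dslope_of_ne _ hzc, slope_def_module]
    refine smul_ne_zero (inv_ne_zero (sub_ne_zero.2 hzc)) (sub_ne_zero.2 fun h => hzc ?_)
    exact hinj hz hc h

/-- Off the pole, `|dslope f c z| = |f z - f c| / |z - c|`. [folklore] -/
theorem norm_dslope_of_ne {z : ℂ} (hzc : z ≠ c) :
    ‖dslope f c z‖ = ‖f z - f c‖ / ‖z - c‖ := by
  rw [dslope_of_ne _ hzc, slope_def_module, norm_smul, norm_inv, div_eq_inv_mul]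

end Slope

/-! ### Properness of a holomorphic bijection onto the disc: the level sets `{|f| ≤ r}` are compact -/

section Proper

variable {D : Set ℂ} {f : ℂ → ℂ}

/-- An injective holomorphic map on an open set is nowhere locally constant. [folklore] -/
theorem not_eventually_const (hD : IsOpen D) (hinj : InjOn f D) {z : ℂ} (hz : z ∈ D) :
    ¬ ∀ᶠ w in 𝓝 z, f w = f z := by
  intro h
  have h' : ∀ᶠ w in 𝓝[≠] z, f w = f z ∧ w ∈ D :=
    nhdsWithin_le_nhds (h.and (hD.mem_nhds hz))
  obtain ⟨w, ⟨hfw, hwD⟩, hwz⟩ := (h'.and self_mem_nhdsWithin).exists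
  exact hwz (hinj hwD hz hfw)

/-- **The inverse of a holomorphic bijection `f : D → f(D)` (`D` open) is continuous on `f(D)`**
(open mapping theorem). [folklore] -/
theorem continuousOn_invFunOn (hD : IsOpen D) (hf : DifferentiableOn ℂ f D) (hinj : InjOn f D) :
    ContinuousOn (Function.invFunOn f D) (f '' D) := by
  classical
  intro w hw
  obtain ⟨z, hz, rfl⟩ := hw
  have hgz : Function.invFunOn f D (f z) = z := hinj.leftInvOn_invFunOn hz
  rw [ContinuousWithinAt, hgz]
  -- open mapping at `z`
  have hmap : 𝓝 (f z) ≤ map f (𝓝 z) :=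
    ((hf.analyticAt (hD.mem_nhds hz)).eventually_constant_or_nhds_le_map_nhds).resolve_left
      (not_eventually_const hD hinj hz)
  rw [tendsto_iff_forall_eventually_mem]
  intro N hN
  have h1 : f '' (N ∩ D) ∈ 𝓝 (f z) :=
    hmap (mem_map.2 (mem_of_superset (inter_mem hN (hD.mem_nhds hz)) (subset_preimage_image f _)))
  filter_upwards [nhdsWithin_le_nhds h1] with y hy
  obtain ⟨x, ⟨hxN, hxD⟩, rfl⟩ := hy
  rwa [hinj.leftInvOn_invFunOn hxD]

/-- **Properness towards the disc**: if `f` maps the open set `D` holomorphically and bijectively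
onto the unit disc, then for `r < 1` the level set `{z ∈ D : |f z| ≤ r}` is compact (it is the
continuous image of the closed disc of radius `r` under `f⁻¹`). [folklore] -/
theorem isCompact_normLevelSet (hD : IsOpen D) (hf : DifferentiableOn ℂ f D)
    (hbij : BijOn f D (ball (0 : ℂ) 1)) {r : ℝ} (hr : r < 1) :
    IsCompact {z | z ∈ D ∧ ‖f z‖ ≤ r} := by
  classical
  set g := Function.invFunOn f D with hg
  have hgc : ContinuousOn g (closedBall (0 : ℂ) r) := by
    have h := continuousOn_invFunOn hD hf hbij.injOn
    rw [hbij.image_eq] at h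
    exact h.mono (closedBall_subset_ball hr)
  have heq : {z | z ∈ D ∧ ‖f z‖ ≤ r} = g '' closedBall (0 : ℂ) r := by
    ext z
    simp only [mem_setOf_eq, mem_image, mem_closedBall, dist_zero_right]
    constructor
    · rintro ⟨hzD, hzr⟩
      exact ⟨f z, hzr, hbij.injOn.leftInvOn_invFunOn hzD⟩
    · rintro ⟨w, hwr, rfl⟩
      have hw : w ∈ ball (0 : ℂ) 1 := mem_ball_zero_iff.2 (hwr.trans_lt hr)
      have hw' : w ∈ f '' D := hbij.image_eq ▸ hw
      exact ⟨Function.invFunOn_mem hw', by rw [Function.invFunOn_eq hw']; exact hwr⟩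
  rw [heq]
  exact (isCompact_closedBall _ _).image_of_continuousOn hgc

/-- The sublevel set `{z ∈ D : |f z| < r}` is open. [folklore] -/
theorem isOpen_normSublevelSet (hD : IsOpen D) (hf : DifferentiableOn ℂ f D) (r : ℝ) :
    IsOpen {z | z ∈ D ∧ ‖f z‖ < r} :=
  (continuous_norm.comp_continuousOn hf.continuousOn).isOpen_inter_preimage hD isOpen_Iio

/-- Its closure stays inside the compact level set `{|f| ≤ r}`, hence inside `D`. [folklore] -/
theorem closure_normSublevelSet_subset (hD : IsOpen D) (hf : DifferentiableOn ℂ f D)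
    (hbij : BijOn f D (ball (0 : ℂ) 1)) {r : ℝ} (hr : r < 1) :
    closure {z | z ∈ D ∧ ‖f z‖ < r} ⊆ {z | z ∈ D ∧ ‖f z‖ ≤ r} :=
  closure_minimal (fun _ hz => ⟨hz.1, hz.2.le⟩) (isCompact_normLevelSet hD hf hbij hr).isClosed

end Proper

/-! ### `ℝ²` bookkeeping through `toC` (`norm_le_norm_toC`, `toC_zero` are in `Process`) -/

/-- A subset of `toC⁻¹ D` is bounded when `D` is. [folklore] -/
theorem isBounded_of_subset_preimage_toC {D : Set ℂ} (hDb : Bornology.IsBounded D)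
    {U : Set (Fin 2 → ℝ)} (hU : U ⊆ toC ⁻¹' D) : Bornology.IsBounded U := by
  obtain ⟨R, hR⟩ := hDb.subset_closedBall 0
  refine isBounded_iff_forall_norm_le.2 ⟨R, fun v hv => ?_⟩
  have h := hR (hU hv)
  rw [mem_closedBall, dist_zero_right] at h
  exact (norm_le_norm_toC v).trans h

/-- The preimage under `toC` of a compact set is compact (`toC` has the continuous inverse `ofC`).
[folklore] -/
theorem isCompact_preimage_toC {K : Set ℂ} (hK : IsCompact K) : IsCompact (toC ⁻¹' K) := by
  have heq : toC ⁻¹' K = ofC '' K := by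
    ext v
    constructor
    · intro hv
      exact ⟨toC v, hv, ofC_toC v⟩
    · rintro ⟨z, hz, rfl⟩
      show toC (ofC z) ∈ K
      rwa [toC_ofC]
  rw [heq]
  exact hK.image continuous_ofC

/-! ### Exit of planar Brownian motion from the level sets `{|f| < r}` and from `D` -/

section Exit

variable {Ω : Type*} {mΩ : MeasurableSpace Ω} {P : Measure Ω}
  {W : ℝ≥0 → Ω → (Fin 2 → ℝ)} {D : Set ℂ} {f : ℂ → ℂ} {x₀ : Fin 2 → ℝ}

/-- **Optional stopping at the exit time `T_r` of the level set `D_r = {|f| < r}`**, `0 < r < 1`: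
`T_r < ∞` a.s., and for the harmonic function `u = log |dslope f x₀|`,
`E[u(X_{T_r})] = u(x₀) = log |f'(x₀)|` (Kakutani's theorem on the relatively compact `D_r`, then
`t → ∞` by dominated convergence). [folklore] -/
theorem integral_log_norm_dslope_exit_level [IsProbabilityMeasure P] (hW : IsBrownianVec W P) (hD : IsOpen D)
    (hDb : Bornology.IsBounded D) (hf : DifferentiableOn ℂ f D) (hbij : BijOn f D (ball (0 : ℂ) 1))
    (hx₀ : toC x₀ ∈ D) (hf0 : f (toC x₀) = 0) (hder : deriv f (toC x₀) ≠ 0)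
    {r : ℝ} (hr0 : 0 < r) (hr1 : r < 1) :
    (∀ᵐ ω ∂P, hitTime x₀ W (toC ⁻¹' {z | z ∈ D ∧ ‖f z‖ < r})ᶜ ω ≠ ⊤) ∧
    Integrable (fun ω => Real.log ‖dslope f (toC x₀)
      (toC (x₀ + W (hitTime x₀ W (toC ⁻¹' {z | z ∈ D ∧ ‖f z‖ < r})ᶜ ω).untopA ω))‖) P ∧
    ∫ ω, Real.log ‖dslope f (toC x₀)
      (toC (x₀ + W (hitTime x₀ W (toC ⁻¹' {z | z ∈ D ∧ ‖f z‖ < r})ᶜ ω).untopA ω))‖ ∂P =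
      Real.log ‖deriv f (toC x₀)‖ := by
  set c := toC x₀ with hc
  set S : Set ℂ := {z | z ∈ D ∧ ‖f z‖ < r} with hS
  set K : Set ℂ := {z | z ∈ D ∧ ‖f z‖ ≤ r} with hK
  set U : Set (Fin 2 → ℝ) := toC ⁻¹' S with hU
  set u : (Fin 2 → ℝ) → ℝ := fun w => Real.log ‖dslope f c (toC w)‖ with hu
  set T := hitTime x₀ W Uᶜ with hT
  -- topology of the level sets
  have hSo : IsOpen S := isOpen_normSublevelSet hD hf r
  have hUo : IsOpen U := hSo.preimage continuous_toC
  have hKc : IsCompact K := isCompact_normLevelSet hD hf hbij hr1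
  have hUD : U ⊆ toC ⁻¹' D := fun v hv => hv.1
  have hUb : Bornology.IsBounded U := isBounded_of_subset_preimage_toC hDb hUD
  have hx₀U : x₀ ∈ U := by
    refine ⟨hx₀, ?_⟩
    show ‖f (toC x₀)‖ < r
    rw [hf0, norm_zero]; exact hr0
  have hclU : closure U ⊆ toC ⁻¹' K :=
    (continuous_toC.closure_preimage_subset S).trans
      (preimage_mono (closure_normSublevelSet_subset hD hf hbij hr1))
  have hKD : toC ⁻¹' K ⊆ toC ⁻¹' D := fun v hv => hv.1
  have hF : IsClosed Uᶜ := hUo.isClosed_compl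
  have hFc : closure Uᶜᶜ ⊆ toC ⁻¹' D := by rw [compl_compl]; exact hclU.trans hKD
  have hbdd : Bornology.IsBounded Uᶜᶜ := by rw [compl_compl]; exact hUb
  have hx₀F : x₀ ∉ Uᶜ := fun h => h hx₀U
  -- the harmonic function `u`
  have hg : DifferentiableOn ℂ (dslope f c) D := differentiableOn_dslope hD hf hx₀
  have hg0 : ∀ z ∈ D, dslope f c z ≠ 0 := fun z hz => dslope_ne_zero hbij.injOn hx₀ hder hz
  have hV : ContDiffOn ℝ 2 u (toC ⁻¹' D) := contDiffOn_log_norm hD hg hg0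
  have hΔ : ∀ y ∈ toC ⁻¹' D, lap u y = 0 := fun y hy => lap_log_norm_eq_zero hD hg hy (hg0 _ hy)
  -- `u` is bounded on the compact `toC⁻¹ K`
  have hKc' : IsCompact (toC ⁻¹' K) := isCompact_preimage_toC hKc
  obtain ⟨C, hC⟩ := hKc'.exists_bound_of_continuousOn (hV.continuousOn.mono hKD)
  -- optional stopping at `t ∧ T`
  have hstop : ∀ t : ℝ≥0, Integrable (stoppedProcess (fun s ω => u (x₀ + W s ω)) T t) P ∧
      ∫ ω, stoppedProcess (fun s ω => u (x₀ + W s ω)) T t ω ∂P = u x₀ := fun t =>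
    hW.integral_stoppedProcess_eq_of_harmonic (isOpen_preimage_toC hD) hV hΔ hF hbdd hFc hx₀F t
  -- the exit time is a.s. finite
  have hfin : ∀ᵐ ω ∂P, T ω ≠ ⊤ := hW.ae_hitTime_ne_top hUo hUb hx₀U
  -- pointwise, the stopped values are eventually the exit value
  have hev : ∀ᵐ ω ∂P, ∀ᶠ n : ℕ in atTop,
      stoppedProcess (fun s ω => u (x₀ + W s ω)) T (n : ℝ≥0) ω = u (x₀ + W (T ω).untopA ω) := by
    filter_upwards [hfin] with ω hω
    obtain ⟨τ, hτ⟩ := WithTop.ne_top_iff_exists.1 hω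
    obtain ⟨N, hN⟩ := exists_nat_ge τ
    refine eventually_atTop.2 ⟨N, fun n hn => ?_⟩
    have hle : T ω ≤ ((n : ℝ≥0) : WithTop ℝ≥0) := by
      rw [← hτ]
      exact WithTop.coe_le_coe.2 (hN.trans (by exact_mod_cast hn))
    exact stoppedProcess_eq_of_ge hle
  -- uniform bound by `C`
  have hbound : ∀ (n : ℕ) (ω : Ω), |stoppedProcess (fun s ω => u (x₀ + W s ω)) T (n : ℝ≥0) ω| ≤ C := by
    intro n ω
    simp only [stoppedProcess]
    have hmem := hW.mem_closure_compl_of_le hF hx₀F (n : ℝ≥0) ω le_rfl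
    rw [compl_compl] at hmem
    have h := hC _ (hclU hmem)
    rwa [Real.norm_eq_abs] at h
  have hmeas : ∀ n : ℕ, AEStronglyMeasurable
      (stoppedProcess (fun s ω => u (x₀ + W s ω)) T (n : ℝ≥0)) P :=
    fun n => (hstop n).1.aestronglyMeasurable
  have hlim_meas : AEStronglyMeasurable (fun ω => u (x₀ + W (T ω).untopA ω)) P :=
    aestronglyMeasurable_of_tendsto_ae atTop hmeas
      (hev.mono fun ω hω => tendsto_nhds_of_eventually_eq hω)
  have hint : Integrable (fun ω => u (x₀ + W (T ω).untopA ω)) P := by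
    refine Integrable.mono' (integrable_const C) hlim_meas ?_
    filter_upwards [hev] with ω hω
    obtain ⟨n, hn⟩ := hω.exists
    rw [Real.norm_eq_abs, ← hn]
    exact hbound n ω
  have hconv := tendsto_integral_of_dominated_convergence (fun _ => C) hmeas (integrable_const C)
    (fun n => ae_of_all _ fun ω => by rw [Real.norm_eq_abs]; exact hbound n ω)
    (hev.mono fun ω hω => tendsto_nhds_of_eventually_eq hω)
  have hconst : Tendsto (fun n : ℕ => ∫ ω, stoppedProcess (fun s ω => u (x₀ + W s ω)) T (n : ℝ≥0) ω ∂P)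
      atTop (𝓝 (u x₀)) := by
    simp_rw [fun n => (hstop n).2]
    exact tendsto_const_nhds
  have hux₀ : u x₀ = Real.log ‖deriv f c‖ := by
    simp only [hu, hc, dslope_same]
  refine ⟨hfin, hint, ?_⟩
  rw [← hux₀]
  exact tendsto_nhds_unique hconv hconst

/-- **The exit point from the level set `{|f| < r}`** lies in `D`, has `|f| = r` exactly, is not
the pole, and there `u = log |dslope f x₀| = log r - log |X_{T_r} - x₀|`. [folklore] -/
theorem exit_level_point (hW : IsBrownianVec W P) (hD : IsOpen D) (hf : DifferentiableOn ℂ f D)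
    (hbij : BijOn f D (ball (0 : ℂ) 1)) (hx₀ : toC x₀ ∈ D) (hf0 : f (toC x₀) = 0)
    {r : ℝ} (hr0 : 0 < r) (hr1 : r < 1) {ω : Ω} {τ : ℝ≥0}
    (hτ : hitTime x₀ W (toC ⁻¹' {z | z ∈ D ∧ ‖f z‖ < r})ᶜ ω = τ) :
    toC (x₀ + W τ ω) ∈ D ∧ ‖f (toC (x₀ + W τ ω))‖ = r ∧ toC (x₀ + W τ ω) ≠ toC x₀ ∧
      Real.log ‖dslope f (toC x₀) (toC (x₀ + W τ ω))‖ =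
        Real.log r - Real.log ‖toC (x₀ + W τ ω) - toC x₀‖ := by
  set S : Set ℂ := {z | z ∈ D ∧ ‖f z‖ < r} with hS
  set U : Set (Fin 2 → ℝ) := toC ⁻¹' S with hU
  have hSo : IsOpen S := isOpen_normSublevelSet hD hf r
  have hUo : IsOpen U := hSo.preimage continuous_toC
  have hF : IsClosed Uᶜ := hUo.isClosed_compl
  have hx₀U : x₀ ∈ U := by
    refine ⟨hx₀, ?_⟩
    show ‖f (toC x₀)‖ < r
    rw [hf0, norm_zero]; exact hr0
  have hx₀F : x₀ ∉ Uᶜ := fun h => h hx₀U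
  have hclU : closure U ⊆ toC ⁻¹' {z | z ∈ D ∧ ‖f z‖ ≤ r} :=
    (continuous_toC.closure_preimage_subset S).trans
      (preimage_mono (closure_normSublevelSet_subset hD hf hbij hr1))
  have hmemF : x₀ + W τ ω ∈ Uᶜ := hW.mem_of_hitTime_eq_coe hF hτ
  have hmemcl : x₀ + W τ ω ∈ closure Uᶜᶜ :=
    hW.mem_closure_compl_of_le hF hx₀F τ ω (by rw [hτ, untopA_min_coe_coe, min_self])
  rw [compl_compl] at hmemcl
  have hK := hclU hmemcl
  have hnot : ¬ (toC (x₀ + W τ ω) ∈ D ∧ ‖f (toC (x₀ + W τ ω))‖ < r) := hmemF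
  have hnorm : ‖f (toC (x₀ + W τ ω))‖ = r :=
    le_antisymm hK.2 (not_lt.1 fun h => hnot ⟨hK.1, h⟩)
  have hne : toC (x₀ + W τ ω) ≠ toC x₀ := by
    intro h
    rw [h, hf0, norm_zero] at hnorm
    exact hr0.ne hnorm
  refine ⟨hK.1, hnorm, hne, ?_⟩
  rw [norm_dslope_of_ne hne, hf0, sub_zero, hnorm,
    Real.log_div hr0.ne' (norm_ne_zero_iff.2 (sub_ne_zero.2 hne))]

/-- **`E[log |X_{T_r} - x₀|] = log r - log |f'(x₀)|`** for the exit time `T_r` of `{|f| < r}`,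
`0 < r < 1` (and the integrand is integrable). [folklore] -/
theorem integral_log_norm_exit_level [IsProbabilityMeasure P] (hW : IsBrownianVec W P) (hD : IsOpen D)
    (hDb : Bornology.IsBounded D) (hf : DifferentiableOn ℂ f D) (hbij : BijOn f D (ball (0 : ℂ) 1))
    (hx₀ : toC x₀ ∈ D) (hf0 : f (toC x₀) = 0) (hder : deriv f (toC x₀) ≠ 0)
    {r : ℝ} (hr0 : 0 < r) (hr1 : r < 1) :
    Integrable (fun ω => Real.log ‖toC (x₀ + W
      (hitTime x₀ W (toC ⁻¹' {z | z ∈ D ∧ ‖f z‖ < r})ᶜ ω).untopA ω) - toC x₀‖) P ∧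
    ∫ ω, Real.log ‖toC (x₀ + W
      (hitTime x₀ W (toC ⁻¹' {z | z ∈ D ∧ ‖f z‖ < r})ᶜ ω).untopA ω) - toC x₀‖ ∂P =
      Real.log r - Real.log ‖deriv f (toC x₀)‖ := by
  obtain ⟨hfin, hint, hval⟩ := integral_log_norm_dslope_exit_level hW hD hDb hf hbij hx₀ hf0 hder hr0 hr1
  set T := hitTime x₀ W (toC ⁻¹' {z | z ∈ D ∧ ‖f z‖ < r})ᶜ with hT
  have hae : (fun ω => Real.log ‖toC (x₀ + W (T ω).untopA ω) - toC x₀‖) =ᵐ[P]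
      fun ω => Real.log r - Real.log ‖dslope f (toC x₀) (toC (x₀ + W (T ω).untopA ω))‖ := by
    filter_upwards [hfin] with ω hω
    obtain ⟨τ, hτ⟩ := WithTop.ne_top_iff_exists.1 hω
    rw [← hτ, untopA_coe]
    have h := (exit_level_point hW hD hf hbij hx₀ hf0 hr0 hr1 hτ.symm).2.2.2
    linarith
  refine ⟨((integrable_const (Real.log r)).sub hint).congr hae.symm, ?_⟩
  rw [integral_congr_ae hae, integral_sub (integrable_const _) hint, integral_const, hval, smul_eq_mul,
    probReal_univ, one_mul]

/-- **Convergence of the level exits to the exit from `D`**: if `T_D = τ < ∞` and the exit times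
`T_{r_m} = σ_m < ∞` for radii `r_m ↑ 1`, then `X_{σ_m} → X_τ` (monotonicity of the exit times,
continuity of the path, and `|f(X_{σ_m})| = r_m → 1`, which forbids a limit point inside `D`).
[folklore] -/
theorem tendsto_exit_level_point (hW : IsBrownianVec W P) (hD : IsOpen D) (hf : DifferentiableOn ℂ f D)
    (hbij : BijOn f D (ball (0 : ℂ) 1)) (hx₀ : toC x₀ ∈ D) (hf0 : f (toC x₀) = 0)
    {rad : ℕ → ℝ} (hrad0 : ∀ m, 0 < rad m) (hrad1 : ∀ m, rad m < 1) (hmono : Monotone rad)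
    (hlim : Tendsto rad atTop (𝓝 1)) {ω : Ω} {τ : ℝ≥0} (hτ : hitTime x₀ W (toC ⁻¹' D)ᶜ ω = τ)
    {σ : ℕ → ℝ≥0} (hσ : ∀ m, hitTime x₀ W (toC ⁻¹' {z | z ∈ D ∧ ‖f z‖ < rad m})ᶜ ω = σ m) :
    Tendsto (fun m => x₀ + W (σ m) ω) atTop (𝓝 (x₀ + W τ ω)) := by
  -- the exit times increase and stay below `τ`
  have hσmono : Monotone σ := by
    refine monotone_nat_of_le_succ fun m => ?_
    have hsub : (toC ⁻¹' {z | z ∈ D ∧ ‖f z‖ < rad (m + 1)})ᶜ ⊆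
        (toC ⁻¹' {z | z ∈ D ∧ ‖f z‖ < rad m})ᶜ :=
      compl_subset_compl.2 (preimage_mono fun z hz => ⟨hz.1, hz.2.trans_le (hmono (Nat.le_succ m))⟩)
    have h := IsBrownianVec.hitTime_mono (x₀ := x₀) (W := W) hsub ω
    rw [hσ m, hσ (m + 1)] at h
    exact WithTop.coe_le_coe.1 h
  have hσle : ∀ m, σ m ≤ τ := fun m => by
    have hsub : (toC ⁻¹' D)ᶜ ⊆ (toC ⁻¹' {z | z ∈ D ∧ ‖f z‖ < rad m})ᶜ :=
      compl_subset_compl.2 (preimage_mono fun z hz => hz.1)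
    have h := IsBrownianVec.hitTime_mono (x₀ := x₀) (W := W) hsub ω
    rw [hσ m, hτ] at h
    exact WithTop.coe_le_coe.1 h
  -- so they converge to some `τ' ≤ τ`
  have hbdd : BddAbove (range σ) := ⟨τ, by rintro _ ⟨m, rfl⟩; exact hσle m⟩
  have hconvσ : Tendsto σ atTop (𝓝 (⨆ m, σ m)) := tendsto_atTop_ciSup hσmono hbdd
  have hτ'le : (⨆ m, σ m) ≤ τ := ciSup_le hσle
  set τ' := ⨆ m, σ m with hτ'
  -- positions converge to `X τ'`
  have hcont : Continuous fun s : ℝ≥0 => x₀ + W s ω := continuous_const.add (hW.continuous_path ω)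
  have hpos : Tendsto (fun m => x₀ + W (σ m) ω) atTop (𝓝 (x₀ + W τ' ω)) :=
    (hcont.tendsto τ').comp hconvσ
  -- at each level the exit point is in `D` with `|f| = rad m`
  have hpt : ∀ m, toC (x₀ + W (σ m) ω) ∈ D ∧ ‖f (toC (x₀ + W (σ m) ω))‖ = rad m := fun m =>
    ⟨(exit_level_point hW hD hf hbij hx₀ hf0 (hrad0 m) (hrad1 m) (hσ m)).1,
      (exit_level_point hW hD hf hbij hx₀ hf0 (hrad0 m) (hrad1 m) (hσ m)).2.1⟩
  -- the limit point is not in `D`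
  have hnotD : toC (x₀ + W τ' ω) ∉ D := by
    intro hmem
    have hct : ContinuousWithinAt f D (toC (x₀ + W τ' ω)) := hf.continuousOn _ hmem
    have h1 : Tendsto (fun m => toC (x₀ + W (σ m) ω)) atTop (𝓝[D] toC (x₀ + W τ' ω)) :=
      tendsto_nhdsWithin_iff.2 ⟨(continuous_toC.tendsto _).comp hpos, Eventually.of_forall fun m => (hpt m).1⟩
    have h2 : Tendsto (fun m => ‖f (toC (x₀ + W (σ m) ω))‖) atTop (𝓝 ‖f (toC (x₀ + W τ' ω))‖) :=
      (continuous_norm.tendsto _).comp (hct.tendsto.comp h1)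
    have h3 : Tendsto (fun m => ‖f (toC (x₀ + W (σ m) ω))‖) atTop (𝓝 1) := by
      have heq : (fun m => ‖f (toC (x₀ + W (σ m) ω))‖) = rad := funext fun m => (hpt m).2
      rw [heq]; exact hlim
    have heq : ‖f (toC (x₀ + W τ' ω))‖ = 1 := tendsto_nhds_unique h2 h3
    have hlt : ‖f (toC (x₀ + W τ' ω))‖ < 1 := by
      have h := hbij.mapsTo hmem
      rwa [mem_ball_zero_iff] at h
    exact hlt.ne heq
  -- hence `T_D ≤ τ'`, so `τ' = τ`
  have hTle : hitTime x₀ W (toC ⁻¹' D)ᶜ ω ≤ τ' :=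
    IsBrownianVec.hitTime_le_of_mem (F := (toC ⁻¹' D)ᶜ) (j := τ') hnotD
  rw [hτ] at hTle
  have hττ' : τ = τ' := le_antisymm (WithTop.coe_le_coe.1 hTle) hτ'le
  rw [hττ']
  exact hpos

/-- **The Green function at the pole against the conformal radius, probabilistically**
(Kozdron–Lawler 2005, §2.2 (11) with §2.4 (17): `E⁰[log |B_{T_D}|] = -log f'(0)`): for a bounded
open `D ⊆ ℂ`, a holomorphic bijection `f` of `D` onto the unit disc, and a planar Brownian motion
`X = x₀ + W` (`IsBrownianVec W P`) started at the point `x₀` with `f(x₀) = 0` and `f'(x₀) ≠ 0`: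
the exit time `T_D` of `D` is a.s. finite, `log |X_{T_D} - x₀|` is integrable, and
`E[log |X_{T_D} - x₀|] = -log |f'(x₀)|`. [cite: KozdronLawler2005, §2.2 eq. (11) and §2.4 eq. (17)] -/
theorem integral_log_norm_exit_eq_neg_log_deriv [IsProbabilityMeasure P] (hW : IsBrownianVec W P) (hD : IsOpen D)
    (hDb : Bornology.IsBounded D) (hf : DifferentiableOn ℂ f D) (hbij : BijOn f D (ball (0 : ℂ) 1))
    (hx₀ : toC x₀ ∈ D) (hf0 : f (toC x₀) = 0) (hder : deriv f (toC x₀) ≠ 0) :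
    (∀ᵐ ω ∂P, hitTime x₀ W (toC ⁻¹' D)ᶜ ω ≠ ⊤) ∧
    Integrable (fun ω => Real.log ‖toC (x₀ + W (hitTime x₀ W (toC ⁻¹' D)ᶜ ω).untopA ω) - toC x₀‖) P ∧
    ∫ ω, Real.log ‖toC (x₀ + W (hitTime x₀ W (toC ⁻¹' D)ᶜ ω).untopA ω) - toC x₀‖ ∂P =
      - Real.log ‖deriv f (toC x₀)‖ := by
  set c := toC x₀ with hc
  set T := hitTime x₀ W (toC ⁻¹' D)ᶜ with hT
  -- the radii `r_m = 1 - 1/(m+2) ↑ 1`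
  set rad : ℕ → ℝ := fun m => 1 - 1 / ((m : ℝ) + 2) with hrad
  have hrad_half : ∀ m, 1 / 2 ≤ rad m := fun m => by
    have h : 1 / ((m : ℝ) + 2) ≤ 1 / 2 :=
      one_div_le_one_div_of_le (by norm_num) (by linarith [(Nat.cast_nonneg m : (0 : ℝ) ≤ m)])
    simp only [hrad]; linarith
  have hrad0 : ∀ m, 0 < rad m := fun m => by linarith [hrad_half m]
  have hrad1 : ∀ m, rad m < 1 := fun m => by
    have h : 0 < 1 / ((m : ℝ) + 2) := by positivity
    simp only [hrad]; linarith
  have hmono : Monotone rad := fun m n hmn => by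
    simp only [hrad]
    have h : 1 / ((n : ℝ) + 2) ≤ 1 / ((m : ℝ) + 2) :=
      one_div_le_one_div_of_le (by positivity) (by simpa using (Nat.cast_le (α := ℝ)).2 hmn)
    linarith
  have hlim : Tendsto rad atTop (𝓝 1) := by
    have h1 : Tendsto (fun m : ℕ => (m : ℝ) + 2) atTop atTop :=
      tendsto_atTop_add_const_right _ 2 tendsto_natCast_atTop_atTop
    have h2 : Tendsto (fun m : ℕ => 1 / ((m : ℝ) + 2)) atTop (𝓝 0) := h1.const_div_atTop 1
    have h3 := h2.const_sub 1
    simpa [hrad] using h3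
  set Tm : ℕ → Ω → WithTop ℝ≥0 := fun m =>
    hitTime x₀ W (toC ⁻¹' {z | z ∈ D ∧ ‖f z‖ < rad m})ᶜ with hTm
  -- per-level identities and finiteness
  have hlev : ∀ m, Integrable (fun ω => Real.log ‖toC (x₀ + W (Tm m ω).untopA ω) - c‖) P ∧
      ∫ ω, Real.log ‖toC (x₀ + W (Tm m ω).untopA ω) - c‖ ∂P = Real.log (rad m) - Real.log ‖deriv f c‖ :=
    fun m => integral_log_norm_exit_level hW hD hDb hf hbij hx₀ hf0 hder (hrad0 m) (hrad1 m)
  have hfinm : ∀ m, ∀ᵐ ω ∂P, Tm m ω ≠ ⊤ := fun m =>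
    (integral_log_norm_dslope_exit_level hW hD hDb hf hbij hx₀ hf0 hder (hrad0 m) (hrad1 m)).1
  -- finiteness of `T`
  have hUo : IsOpen (toC ⁻¹' D) := isOpen_preimage_toC hD
  have hUb : Bornology.IsBounded (toC ⁻¹' D) := isBounded_of_subset_preimage_toC hDb subset_rfl
  have hfin : ∀ᵐ ω ∂P, T ω ≠ ⊤ := hW.ae_hitTime_ne_top hUo hUb hx₀
  -- geometric constants: `D ⊆ B̄(0, R)`, and `|f| < 1/2` on `B(c, δ) ⊆ D`
  obtain ⟨R, hRpos, hR⟩ := hDb.subset_closedBall_lt 0 0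
  obtain ⟨δ, hδ0, hδ⟩ : ∃ δ > 0, ∀ z, dist z c < δ → z ∈ D ∧ ‖f z‖ < 1 / 2 := by
    have h1 : ∀ᶠ z in 𝓝 c, z ∈ D := hD.mem_nhds hx₀
    have hct : ContinuousAt f c := (hf.continuousOn c hx₀).continuousAt (hD.mem_nhds hx₀)
    have h2 : ∀ᶠ z in 𝓝 c, ‖f z‖ < 1 / 2 := by
      have hball : ball (0 : ℂ) (1 / 2) ∈ 𝓝 (f c) := by
        rw [hf0]; exact isOpen_ball.mem_nhds (mem_ball_self (by norm_num))
      filter_upwards [hct hball] with z hz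
      rwa [mem_preimage, mem_ball_zero_iff] at hz
    exact Metric.eventually_nhds_iff.1 (h1.and h2)
  set B : ℝ := max |Real.log δ| |Real.log (2 * R)| with hB
  -- bound on the level exit points: `δ ≤ |X_{σ} - c| ≤ 2R`
  have hptbound : ∀ m ω (σ : ℝ≥0), Tm m ω = σ →
      |Real.log ‖toC (x₀ + W σ ω) - c‖| ≤ B := by
    intro m ω σ hσ
    obtain ⟨hzD, hnorm, hne, -⟩ := exit_level_point hW hD hf hbij hx₀ hf0 (hrad0 m) (hrad1 m) hσ
    set z := toC (x₀ + W σ ω) with hz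
    have hup : ‖z - c‖ ≤ 2 * R := by
      have h1 : ‖z‖ ≤ R := by simpa [dist_zero_right] using hR hzD
      have h2 : ‖c‖ ≤ R := by simpa [dist_zero_right] using hR hx₀
      calc ‖z - c‖ ≤ ‖z‖ + ‖c‖ := norm_sub_le _ _
        _ ≤ 2 * R := by linarith
    have hlow : δ ≤ ‖z - c‖ := by
      by_contra h
      push Not at h
      have h' := (hδ z (by rwa [dist_eq_norm])).2
      rw [hnorm] at h'
      linarith [hrad_half m]
    have hpos : 0 < ‖z - c‖ := hδ0.trans_le hlow
    have hlog1 : Real.log δ ≤ Real.log ‖z - c‖ := Real.log_le_log hδ0 hlow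
    have hlog2 : Real.log ‖z - c‖ ≤ Real.log (2 * R) := Real.log_le_log hpos hup
    rw [abs_le]
    constructor
    · exact (neg_le.1 ((neg_le_abs _).trans (le_max_left _ _))).trans hlog1 |>.trans' le_rfl
    · exact hlog2.trans ((le_abs_self _).trans (le_max_right _ _))
  -- the good event
  have hgood : ∀ᵐ ω ∂P, T ω ≠ ⊤ ∧ ∀ m, Tm m ω ≠ ⊤ := hfin.and (ae_all_iff.2 hfinm)
  -- pathwise convergence on the good event
  have hconvpt : ∀ᵐ ω ∂P, Tendsto (fun m => Real.log ‖toC (x₀ + W (Tm m ω).untopA ω) - c‖) atTop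
      (𝓝 (Real.log ‖toC (x₀ + W (T ω).untopA ω) - c‖)) := by
    filter_upwards [hgood] with ω hω
    obtain ⟨τ, hτ⟩ := WithTop.ne_top_iff_exists.1 hω.1
    choose σ hσ using fun m => WithTop.ne_top_iff_exists.1 (hω.2 m)
    have hpos := tendsto_exit_level_point hW hD hf hbij hx₀ hf0 hrad0 hrad1 hmono hlim hτ.symm
      (fun m => (hσ m).symm)
    have heqT : (T ω).untopA = τ := by rw [← hτ]; rfl
    have heqm : ∀ m, (Tm m ω).untopA = σ m := fun m => by rw [← hσ m]; rfl
    simp_rw [heqm, heqT]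
    -- the limit point is off the pole: it lies outside `D ∋ c`
    have hmem : x₀ + W τ ω ∈ (toC ⁻¹' D)ᶜ := hW.mem_of_hitTime_eq_coe hUo.isClosed_compl hτ.symm
    have hne : toC (x₀ + W τ ω) - c ≠ 0 := by
      intro h
      apply hmem
      show toC (x₀ + W τ ω) ∈ D
      rw [sub_eq_zero.1 h]; exact hx₀
    have h1 : Tendsto (fun m => toC (x₀ + W (σ m) ω) - c) atTop (𝓝 (toC (x₀ + W τ ω) - c)) :=
      ((continuous_toC.tendsto _).comp hpos).sub_const c
    exact (Real.continuousAt_log (norm_ne_zero_iff.2 hne)).tendsto.comp ((continuous_norm.tendsto _).comp h1)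
  -- uniform bound on the good event
  have hbd : ∀ m, ∀ᵐ ω ∂P, ‖Real.log ‖toC (x₀ + W (Tm m ω).untopA ω) - c‖‖ ≤ B := by
    intro m
    filter_upwards [hfinm m] with ω hω
    obtain ⟨σ, hσ⟩ := WithTop.ne_top_iff_exists.1 hω
    have heq : (Tm m ω).untopA = σ := by rw [← hσ]; rfl
    rw [Real.norm_eq_abs, heq]
    exact hptbound m ω σ hσ.symm
  -- dominated convergence
  have hmeas : ∀ m, AEStronglyMeasurable (fun ω => Real.log ‖toC (x₀ + W (Tm m ω).untopA ω) - c‖) P :=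
    fun m => (hlev m).1.aestronglyMeasurable
  have hlim_meas : AEStronglyMeasurable (fun ω => Real.log ‖toC (x₀ + W (T ω).untopA ω) - c‖) P :=
    aestronglyMeasurable_of_tendsto_ae atTop hmeas hconvpt
  have hint : Integrable (fun ω => Real.log ‖toC (x₀ + W (T ω).untopA ω) - c‖) P := by
    refine Integrable.mono' (integrable_const B) hlim_meas ?_
    have hall : ∀ᵐ ω ∂P, ∀ m, ‖Real.log ‖toC (x₀ + W (Tm m ω).untopA ω) - c‖‖ ≤ B := ae_all_iff.2 hbd
    filter_upwards [hconvpt, hall] with ω hω hωB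
    exact le_of_tendsto ((continuous_norm.tendsto _).comp hω) (Eventually.of_forall hωB)
  have hconv := tendsto_integral_of_dominated_convergence (fun _ => B) hmeas (integrable_const B) hbd hconvpt
  have hvals : Tendsto (fun m => ∫ ω, Real.log ‖toC (x₀ + W (Tm m ω).untopA ω) - c‖ ∂P) atTop
      (𝓝 (- Real.log ‖deriv f c‖)) := by
    simp_rw [fun m => (hlev m).2]
    have h : Tendsto (fun m => Real.log (rad m)) atTop (𝓝 (Real.log 1)) :=
      (Real.continuousAt_log one_ne_zero).tendsto.comp hlim
    rw [Real.log_one] at h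
    simpa using h.sub_const (Real.log ‖deriv f c‖)
  exact ⟨hfin, hint, tendsto_nhds_unique hconv hvals⟩

/-! ### The union-of-squares domain of `A ∈ 𝒜ⁿ` -/

/-- The closed unit square centred at a site lies in the closed disc of radius `1` about it.
[folklore] -/
theorem unitSquare_subset_closedBall (x : Site 2) :
    Literature.Probability.RandomPlanarGeometry.ChordalLERW.unitSquare x ⊆
      closedBall (Site.toComplex x) 1 := by
  intro z hz
  obtain ⟨h1, h2⟩ := hz
  rw [mem_closedBall, dist_eq_norm]
  have hre : (z - Site.toComplex x).re = z.re - ((x 0 : ℤ) : ℝ) := by simp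
  have him : (z - Site.toComplex x).im = z.im - ((x 1 : ℤ) : ℝ) := by simp
  calc ‖z - Site.toComplex x‖ ≤ |(z - Site.toComplex x).re| + |(z - Site.toComplex x).im| :=
        Complex.norm_le_abs_re_add_abs_im _
    _ ≤ 1 / 2 + 1 / 2 := by rw [hre, him]; exact add_le_add h1 h2
    _ = 1 := by norm_num

/-- The union-of-squares domain `Ã` of a finite `A` is bounded. [folklore] -/
theorem isBounded_squareDomain (A : Finset (Site 2)) : Bornology.IsBounded (squareDomain A) := by
  refine Bornology.IsBounded.subset ?_ interior_subset
  refine (Bornology.isBounded_biUnion_finset A).2 fun x _ => ?_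
  exact isBounded_closedBall.subset (unitSquare_subset_closedBall x)

/-- The union-of-squares domain is open. [folklore] -/
theorem isOpen_squareDomain (A : Finset (Site 2)) : IsOpen (squareDomain A) := isOpen_interior

/-- If `0 ∈ A`, the origin lies in `Ã` (with the open square around it). [folklore] -/
theorem zero_mem_squareDomain {A : Finset (Site 2)} (h0 : (0 : Site 2) ∈ A) :
    (0 : ℂ) ∈ squareDomain A := by
  set O : Set ℂ := {z | |z.re| < 1 / 2 ∧ |z.im| < 1 / 2} with hO
  have hOo : IsOpen O :=
    (isOpen_lt (continuous_abs.comp Complex.continuous_re) continuous_const).inter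
      (isOpen_lt (continuous_abs.comp Complex.continuous_im) continuous_const)
  have hOsub : O ⊆ ⋃ x ∈ A, Literature.Probability.RandomPlanarGeometry.ChordalLERW.unitSquare x := by
    intro z hz
    refine mem_iUnion₂.2 ⟨0, h0, ?_⟩
    exact ⟨by simpa using hz.1.le, by simpa using hz.2.le⟩
  have h0O : (0 : ℂ) ∈ O := by simp [hO]
  exact interior_maximal hOsub hOo h0O

/-- **Kozdron–Lawler's continuum input at the origin of `Ã`**: for `A ∋ 0` finite, a Riemann map
`f` of the union-of-squares domain `Ã` (`IsUnitDiscMap A f`: `f(0) = 0`, `f'(0) > 0`) and a planar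
Brownian motion `W` from `0`, the exit time `T_Ã` is a.s. finite and
`E⁰[log |W_{T_Ã}|] = -log f'(0)` ("`g_A(x) = Eˣ[log |B_{T_A}|] - log |x|`", eq. (11), with
"`lim_{|x|→0}(g_A(x) + log |x|) = -log f_A'(0)`", remark after Cor. 2.6).
[cite: KozdronLawler2005, §2.2 eq. (11) and Cor. 2.6] -/
theorem integral_log_norm_exit_squareDomain [IsProbabilityMeasure P] (hW : IsBrownianVec W P)
    {A : Finset (Site 2)} (h0 : (0 : Site 2) ∈ A) {f : ℂ → ℂ} (hf : IsUnitDiscMap A f) :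
    (∀ᵐ ω ∂P, hitTime 0 W (toC ⁻¹' squareDomain A)ᶜ ω ≠ ⊤) ∧
    Integrable (fun ω => Real.log ‖toC (W (hitTime 0 W (toC ⁻¹' squareDomain A)ᶜ ω).untopA ω)‖) P ∧
    ∫ ω, Real.log ‖toC (W (hitTime 0 W (toC ⁻¹' squareDomain A)ᶜ ω).untopA ω)‖ ∂P =
      - Real.log ‖deriv f 0‖ := by
  obtain ⟨hdiff, hbij, hf0, hre, him⟩ := hf
  have hx₀ : toC (0 : Fin 2 → ℝ) ∈ squareDomain A := by rw [toC_zero]; exact zero_mem_squareDomain h0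
  have hf0' : f (toC (0 : Fin 2 → ℝ)) = 0 := by rw [toC_zero]; exact hf0
  have hder : deriv f (toC (0 : Fin 2 → ℝ)) ≠ 0 := by
    rw [toC_zero]
    intro h
    rw [h, Complex.zero_re] at hre
    exact lt_irrefl _ hre
  have h := integral_log_norm_exit_eq_neg_log_deriv hW (isOpen_squareDomain A) (isBounded_squareDomain A)
    hdiff hbij hx₀ hf0' hder
  simp only [zero_add, toC_zero, sub_zero] at h
  exact h

end Exit

end KozdronLawler

end Literature.Probability.LatticeModels

end
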